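import Mathlib
import HarnessLib
import Summits.HubbardSuperconductivity.HubbardSuperconductivity.Theorems.EnslavedA1gUpperSandwichRemovalAlgebra
import Summits.HubbardSuperconductivity.HubbardSuperconductivity.Theorems.BalabanIRBirGappedPhaseReductionSectorFourier
import Literature.MathematicalPhysics.QuantumLattice.HubbardHubbardModelEtaPairingProofs

/-!
# Route `EnslavedA1g`, support `EnslavedA1gUpperSandwich` (item `stmt-HubbardSuperconductivity-0938`):
# the two-electron removal window (helper file 3/4)

The lower half of the pair chemical-potential window used by the upper sandwich. First two generic
facts on sector energies `minEnergyOn H K` (`H` Hermitian): the homogeneous variational principle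
`minEnergyOn H K · ‖w‖² ≤ Re ⟨w, H w⟩` for `w ∈ K` (`minEnergyOn_mul_le_re`) and its converse for a
nontrivial sector (`le_minEnergyOn_of_forall`). Then, for the repulsive (`U ≥ 0`) Hubbard
Hamiltonian on a finite graph of maximal degree `≤ Δ`,

* `removal_step` — for `φ` in Lieb's sector `(a', b')` and the trial vectors `c_{xσ} φ` (all in
  the sector `(a, b)` obtained by removing one spin-`σ` electron): if `E ‖w‖² ≤ Re ⟨w, H w⟩` on the
  sector `(a, b)` then `E ‖φ‖² ≤ Re ⟨φ, H φ⟩ + Δ|t| ‖φ‖²`. Averaging over `x`: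
  `Σ_x ⟨c_{xσ}φ, H c_{xσ}φ⟩ = n_σ ⟨φ, Hφ⟩ + Σ_x ⟨c_{xσ}φ, [H, c_{xσ}]φ⟩` with
  `[H, c_{xσ}] = t Σ_{y∼x} c_{yσ} - U n_{xσ̄} c_{xσ}`; the interaction term is `≤ 0` for `U ≥ 0`
  and the hopping term is at most `Δ|t| Σ_x ‖c_{xσ}φ‖² = Δ|t| n_σ ‖φ‖²`;
* `minEnergyOn_sector_le_add` — hence `E(a, b) ≤ E(a', b') + Δ|t|` for the sector energies
  (`(a', b') = (a + 1, b)` or `(a, b + 1)`, `a', b' ≤ |Λ|`);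
* `minEnergyOn_szSector_le_add_two` — on the torus `(ℤ/Lℤ)²` (`Δ = 4`):
  `E(2n, 0) ≤ E(2n + 2, 0) + 8|t|` for `n + 1 ≤ L²`.

This is the elementary "Euler removal" estimate `E_N ≤ E_{N+1} + 4t` of the route's item
`PairChemicalPotentialWindow`, done spin by spin through the sector `(n + 1, n)`.
Sources: E. H. Lieb, PRL 62 (1989) 1201 (sectors); D. Ruelle, *Statistical Mechanics* (1969)
§3.4 (a priori bounds in the density); H. Tasaki (2020) §2.1 (variational principle). Folklore.
-/

noncomputable section

-- the mandated namespace `Summit.<Summit>.<Problem>.Theorems` repeats `HubbardSuperconductivity`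
set_option linter.dupNamespace false

namespace Summit.HubbardSuperconductivity.HubbardSuperconductivity.Theorems.EnslavedA1g.UpperSandwich

open Matrix Finset
open Literature.MathematicalPhysics.QuantumLattice
open scoped ComplexOrder

/-! ### Generic linear algebra -/

section Generic

variable {m : Type*} [Fintype m]

/-- `0 ≤ Re ⟨a, a⟩`. [folklore] -/
theorem re_star_dotProduct_self_nonneg (a : m → ℂ) : 0 ≤ (star a ⬝ᵥ a).re :=
  (Complex.nonneg_iff.1 (dotProduct_star_self_nonneg a)).1

variable [DecidableEq m]

/-- **Homogeneous variational principle in a sector**: for a Hermitian `H`, a subspace `K` and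
`w ∈ K`, `minEnergyOn H K · ‖w‖² ≤ Re ⟨w, H w⟩` (normalise `w ≠ 0`; the Rayleigh set is bounded
below by the ground energy). Tasaki (2020) §2.1–2.2. [folklore] -/
theorem minEnergyOn_mul_le_re {H : Matrix m m ℂ} (hH : H.IsHermitian) (K : Submodule ℂ (m → ℂ))
    {w : m → ℂ} (hw : w ∈ K) :
    H.minEnergyOn K * (star w ⬝ᵥ w).re ≤ (star w ⬝ᵥ (H *ᵥ w)).re := by
  by_cases h0 : w = 0
  · subst h0; simp
  obtain ⟨c, -, hc1⟩ := exists_smul_unit h0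
  have hmem : c • w ∈ K := K.smul_mem c hw
  have hle : H.minEnergyOn K ≤ (star (c • w) ⬝ᵥ (H *ᵥ (c • w))).re := by
    refine csInf_le ⟨H.groundEnergy, ?_⟩ ⟨c • w, hmem, hc1, rfl⟩
    rintro E ⟨φ, -, hφ1, rfl⟩
    exact Matrix.groundEnergy_le_rayleigh_holds hH φ hφ1
  have hcc : star c * c = ((‖c‖ ^ 2 : ℝ) : ℂ) := by
    rw [Complex.star_def, Complex.conj_mul']
    push_cast
    rfl
  rw [mulVec_smul, star_smul, smul_dotProduct, dotProduct_smul, smul_smul, hcc, smul_eq_mul,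
    Complex.re_ofReal_mul] at hle
  rw [star_smul, smul_dotProduct, dotProduct_smul, smul_smul, hcc, smul_eq_mul] at hc1
  have h1 : ‖c‖ ^ 2 * (star w ⬝ᵥ w).re = 1 := by
    have := congrArg Complex.re hc1
    rwa [Complex.re_ofReal_mul, Complex.one_re] at this
  have hpos : 0 < ‖c‖ ^ 2 := by
    by_contra hle0
    have : ‖c‖ ^ 2 = 0 := le_antisymm (not_lt.1 hle0) (by positivity)
    rw [this, zero_mul] at h1
    exact zero_ne_one h1
  have key : ‖c‖ ^ 2 * (H.minEnergyOn K * (star w ⬝ᵥ w).re) ≤ ‖c‖ ^ 2 * (star w ⬝ᵥ (H *ᵥ w)).re :=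
    calc ‖c‖ ^ 2 * (H.minEnergyOn K * (star w ⬝ᵥ w).re)
        = H.minEnergyOn K * (‖c‖ ^ 2 * (star w ⬝ᵥ w).re) := by ring
      _ = H.minEnergyOn K := by rw [h1, mul_one]
      _ ≤ ‖c‖ ^ 2 * (star w ⬝ᵥ (H *ᵥ w)).re := hle
  exact le_of_mul_le_mul_left key hpos

omit [DecidableEq m] in
/-- Conversely, a uniform lower bound on the Rayleigh quotients of the unit vectors of a
NONTRIVIAL sector bounds the sector energy from below (`le_csInf`). Tasaki (2020) §2.2. [folklore] -/
theorem le_minEnergyOn_of_forall {H : Matrix m m ℂ} (K : Submodule ℂ (m → ℂ)) {w₀ : m → ℂ}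
    (hw₀ : w₀ ∈ K) (hw₀0 : w₀ ≠ 0) {B : ℝ}
    (hB : ∀ w ∈ K, star w ⬝ᵥ w = 1 → B ≤ (star w ⬝ᵥ (H *ᵥ w)).re) : B ≤ H.minEnergyOn K := by
  obtain ⟨c, -, hc1⟩ := exists_smul_unit hw₀0
  refine le_csInf ⟨_, c • w₀, K.smul_mem c hw₀, hc1, rfl⟩ ?_
  rintro E ⟨w, hw, hw1, rfl⟩
  exact hB w hw hw1

end Generic

/-! ### Two real inequalities -/

section Real

variable {m : Type*} [Fintype m]

/-- `2 |Re ⟨p, q⟩| ≤ ‖p‖² + ‖q‖²` (from `‖p ± q‖² ≥ 0`). [folklore] -/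
theorem two_mul_abs_re_star_dotProduct_le (p q : m → ℂ) :
    2 * |(star p ⬝ᵥ q).re| ≤ (star p ⬝ᵥ p).re + (star q ⬝ᵥ q).re := by
  have h1 := re_star_dotProduct_self_nonneg (p - q)
  have h2 := re_star_dotProduct_self_nonneg (p + q)
  rw [star_sub, sub_dotProduct, dotProduct_sub, dotProduct_sub] at h1
  rw [star_add, add_dotProduct, dotProduct_add, dotProduct_add] at h2
  simp only [Complex.sub_re, Complex.add_re] at h1 h2
  have hsym : (star q ⬝ᵥ p).re = (star p ⬝ᵥ q).re := by
    rw [Matrix.star_dotProduct q p, Complex.star_def, Complex.conj_re]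
  rw [hsym] at h1 h2
  rcases le_or_gt 0 (star p ⬝ᵥ q).re with h | h
  · rw [abs_of_nonneg h]; linarith
  · rw [abs_of_neg h]; linarith

end Real

/-! ### The removal step on a finite graph -/

section Graph

variable {Λ : Type*} [LinearOrder Λ] [Fintype Λ] (G : SimpleGraph Λ) [DecidableRel G.Adj]

omit [LinearOrder Λ] in
/-- `Σ_y [x ∼ y] r = deg(x) · r`. [folklore] -/
theorem sum_ite_adj_const (x : Λ) (r : ℝ) :
    ∑ y : Λ, (if G.Adj x y then r else 0) = (Finset.univ.filter (G.Adj x)).card * r := by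
  rw [← Finset.sum_filter, Finset.sum_const, nsmul_eq_mul]

omit [LinearOrder Λ] in
/-- Degree-weighted double sums: `Σ_x Σ_{y ∼ x} (f x + f y)/2 ≤ Δ Σ_x f x` for `f ≥ 0` on a graph
of maximal degree `≤ Δ`. [folklore] -/
theorem sum_sum_adj_le {Δ : ℕ} (hΔ : ∀ x : Λ, (Finset.univ.filter (G.Adj x)).card ≤ Δ)
    {f : Λ → ℝ} (hf : ∀ x, 0 ≤ f x) :
    ∑ x : Λ, ∑ y : Λ, (if G.Adj x y then (f x + f y) / 2 else 0) ≤ Δ * ∑ x : Λ, f x := by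
  have hsplit : ∀ x y : Λ, (if G.Adj x y then (f x + f y) / 2 else 0) =
      (if G.Adj x y then f x / 2 else 0) + (if G.Adj y x then f y / 2 else 0) := by
    intro x y
    by_cases h : G.Adj x y
    · rw [if_pos h, if_pos h, if_pos (G.adj_symm h)]; ring
    · rw [if_neg h, if_neg h, if_neg (fun h' => h (G.adj_symm h'))]; ring
  simp only [hsplit, Finset.sum_add_distrib]
  rw [Finset.sum_comm (f := fun x y => if G.Adj y x then f y / 2 else 0)]
  simp only [sum_ite_adj_const]
  rw [← Finset.sum_add_distrib, Finset.mul_sum]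
  refine Finset.sum_le_sum fun x _ => ?_
  have hx : ((Finset.univ.filter (G.Adj x)).card : ℝ) ≤ Δ := by exact_mod_cast hΔ x
  have := mul_le_mul_of_nonneg_right hx (hf x)
  linarith

/-- The interaction part of `⟨c_{xσ}φ, [H, c_{xσ}]φ⟩` has a sign:
`Re ⟨w, n_{xτ} w⟩ = ‖c_{xτ} w‖² ≥ 0`. [folklore] -/
theorem re_star_dotProduct_numberOp_mulVec_nonneg (x : Λ) (τ : Fin 2) (w : Fock (Orb Λ)) :
    0 ≤ (star w ⬝ᵥ (numberOp x τ *ᵥ w)).re := by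
  rw [show numberOp x τ = creation (orb x τ) * annihilation (orb x τ) from rfl,
    ThermodynamicLimit.dotProduct_creation_mul_annihilation_mulVec]
  exact re_star_dotProduct_self_nonneg _

/-- **The removal step.** `H = hamiltonian G t U` with `U ≥ 0` on a graph of maximal degree
`≤ Δ`; `φ` in Lieb's sector `(a', b')` with `n_σ > 0` spin-`σ` electrons (`n_↑ = a'`,
`n_↓ = b'`), all of whose one-electron removals `c_{xσ} φ` lie in the sector `(a, b)`. If
`E ‖w‖² ≤ Re ⟨w, H w⟩` on the sector `(a, b)`, then `E ‖φ‖² ≤ Re ⟨φ, H φ⟩ + Δ |t| ‖φ‖²`.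
(Average the trial vectors `c_{xσ}φ`: total weight `n_σ‖φ‖²`, total energy
`n_σ Re⟨φ,Hφ⟩ + Σ_x Re⟨c_{xσ}φ, [H,c_{xσ}]φ⟩ ≤ n_σ (Re⟨φ,Hφ⟩ + Δ|t|‖φ‖²)`.)
Ruelle (1969) §3.4 (classical analogue); Tasaki (2020) §2.1. [folklore] -/
theorem removal_step {Δ : ℕ} (hΔ : ∀ x : Λ, (Finset.univ.filter (G.Adj x)).card ≤ Δ) (t : ℝ)
    {U : ℝ} (hU : 0 ≤ U) (σ : Fin 2) {a' b' a b : ℕ} {φ : Fock (Orb Λ)}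
    (hφ : IsInSector a' b' φ) (hpos : 0 < (if σ = 0 then a' else b' : ℕ))
    (hlow : ∀ x : Λ, IsInSector a b (annihilation (orb x σ) *ᵥ φ)) {E : ℝ}
    (hE : ∀ w : Fock (Orb Λ), IsInSector a b w →
      E * (star w ⬝ᵥ w).re ≤ (star w ⬝ᵥ (hamiltonian G t U *ᵥ w)).re) :
    E * (star φ ⬝ᵥ φ).re ≤
      (star φ ⬝ᵥ (hamiltonian G t U *ᵥ φ)).re + Δ * |t| * (star φ ⬝ᵥ φ).re := by
  set H := hamiltonian G t U with hH
  set w : Λ → Fock (Orb Λ) := fun x => annihilation (orb x σ) *ᵥ φ with hw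
  set f : Λ → ℝ := fun x => (star (w x) ⬝ᵥ w x).re with hf
  set k : ℕ := (if σ = 0 then a' else b' : ℕ) with hk
  have hf0 : ∀ x, 0 ≤ f x := fun x => re_star_dotProduct_self_nonneg _
  have hkC : ((k : ℕ) : ℂ) = ((k : ℝ) : ℂ) := by norm_cast
  have hk0 : (0 : ℝ) < k := by exact_mod_cast hpos
  -- total weight `Σ_x ‖c_{xσ}φ‖² = k ‖φ‖²`
  have hW : ∑ x, f x = k * (star φ ⬝ᵥ φ).re := by
    have h := congrArg Complex.re (sum_star_annihilation_mulVec_dotProduct_of_isInSector hφ σ φ)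
    rw [Complex.re_sum, hkC, Complex.re_ofReal_mul] at h
    exact h
  -- the diagonal part of the energy `Σ_x Re⟨c_{xσ}φ, c_{xσ} Hφ⟩ = k Re⟨φ, Hφ⟩`
  have hD : ∑ x, (star (w x) ⬝ᵥ (annihilation (orb x σ) *ᵥ (H *ᵥ φ))).re =
      k * (star φ ⬝ᵥ (H *ᵥ φ)).re := by
    have h := congrArg Complex.re
      (sum_star_annihilation_mulVec_dotProduct_of_isInSector hφ σ (H *ᵥ φ))
    rw [Complex.re_sum, hkC, Complex.re_ofReal_mul] at h
    exact h
  -- the commutator part, site by site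
  have hC : ∀ x, (star (w x) ⬝ᵥ ((H * annihilation (orb x σ) - annihilation (orb x σ) * H) *ᵥ φ)).re
      ≤ |t| * ∑ y, (if G.Adj x y then (f x + f y) / 2 else 0) := by
    intro x
    rw [hH, hamiltonian_commutator_annihilation, sub_mulVec, smul_mulVec, smul_mulVec,
      Matrix.sum_mulVec, ← mulVec_mulVec, dotProduct_sub, dotProduct_smul, dotProduct_smul,
      dotProduct_sum, Complex.sub_re, smul_eq_mul, smul_eq_mul, Complex.re_ofReal_mul,
      Complex.re_ofReal_mul, Complex.re_sum, Finset.mul_sum, Finset.mul_sum]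
    have hint : 0 ≤ U * (star (w x) ⬝ᵥ (numberOp x (σ + 1) *ᵥ w x)).re :=
      mul_nonneg hU (re_star_dotProduct_numberOp_mulVec_nonneg x _ _)
    have hhop : ∀ y, t * (star (w x) ⬝ᵥ ((if G.Adj x y then annihilation (orb y σ) else 0) *ᵥ φ)).re
        ≤ |t| * (if G.Adj x y then (f x + f y) / 2 else 0) := by
      intro y
      by_cases hxy : G.Adj x y
      · rw [if_pos hxy, if_pos hxy]
        have h2 := two_mul_abs_re_star_dotProduct_le (w x) (w y)
        have h3 : t * (star (w x) ⬝ᵥ w y).re ≤ |t| * |(star (w x) ⬝ᵥ w y).re| := by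
          rw [← abs_mul]; exact le_abs_self _
        have h4 : |t| * |(star (w x) ⬝ᵥ w y).re| ≤ |t| * ((f x + f y) / 2) :=
          mul_le_mul_of_nonneg_left (by simp only [hf]; linarith) (abs_nonneg t)
        exact h3.trans h4
      · rw [if_neg hxy, if_neg hxy, zero_mulVec, dotProduct_zero, Complex.zero_re, mul_zero,
          mul_zero]
    have hsum := Finset.sum_le_sum fun y (_ : y ∈ Finset.univ) => hhop y
    linarith
  -- energies of the trial vectors
  have hen : ∀ x, (star (w x) ⬝ᵥ (H *ᵥ w x)).re =
      (star (w x) ⬝ᵥ (annihilation (orb x σ) *ᵥ (H *ᵥ φ))).re +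
        (star (w x) ⬝ᵥ ((H * annihilation (orb x σ) - annihilation (orb x σ) * H) *ᵥ φ)).re := by
    intro x
    rw [← Complex.add_re, ← dotProduct_add, sub_mulVec, ← mulVec_mulVec, ← mulVec_mulVec,
      add_sub_cancel]
  -- variational bound on each trial vector, summed
  have hvar : ∀ x, E * f x ≤ (star (w x) ⬝ᵥ (H *ᵥ w x)).re := fun x => hE (w x) (hlow x)
  have hmain : E * (k * (star φ ⬝ᵥ φ).re) ≤
      k * (star φ ⬝ᵥ (H *ᵥ φ)).re + |t| * (Δ * (k * (star φ ⬝ᵥ φ).re)) := by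
    have h1 : ∑ x, E * f x ≤ ∑ x, ((star (w x) ⬝ᵥ (annihilation (orb x σ) *ᵥ (H *ᵥ φ))).re +
        |t| * ∑ y, (if G.Adj x y then (f x + f y) / 2 else 0)) :=
      Finset.sum_le_sum fun x _ => by linarith [hvar x, hC x, hen x]
    rw [← Finset.mul_sum, hW, Finset.sum_add_distrib, hD, ← Finset.mul_sum] at h1
    have h2 := sum_sum_adj_le G hΔ hf0
    rw [hW] at h2
    have h3 := mul_le_mul_of_nonneg_left h2 (abs_nonneg t)
    linarith
  -- divide by `k > 0`
  have hmain' : k * (E * (star φ ⬝ᵥ φ).re) ≤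
      k * ((star φ ⬝ᵥ (H *ᵥ φ)).re + Δ * |t| * (star φ ⬝ᵥ φ).re) := by
    have : k * (E * (star φ ⬝ᵥ φ).re) = E * (k * (star φ ⬝ᵥ φ).re) := by ring
    rw [this]
    refine hmain.trans (le_of_eq ?_)
    ring
  exact le_of_mul_le_mul_left hmain' hk0

/-- **One-electron removal costs at most `Δ|t|` in sector energy.** With
`K(a, b) = szSector (a + b) ((a - b)/2)` (Lieb's sector `(a, b)`), `U ≥ 0`, maximal degree `≤ Δ`,
and `(a', b') ∈ {(a + 1, b), (a, b + 1)}` with `a', b' ≤ |Λ|`: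
`minEnergyOn H K(a, b) ≤ minEnergyOn H K(a', b') + Δ |t|`. [folklore] -/
theorem minEnergyOn_sector_le_add {Δ : ℕ} (hΔ : ∀ x : Λ, (Finset.univ.filter (G.Adj x)).card ≤ Δ)
    (t : ℝ) {U : ℝ} (hU : 0 ≤ U) (σ : Fin 2) (a b : ℕ)
    (ha : (if σ = 0 then a + 1 else a) ≤ Fintype.card Λ)
    (hb : (if σ = 0 then b else b + 1) ≤ Fintype.card Λ) :
    (hamiltonian G t U).minEnergyOn (szSector (a + b) (((a : ℝ) - b) / 2)) ≤
      (hamiltonian G t U).minEnergyOn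
          (szSector ((if σ = 0 then a + 1 else a) + (if σ = 0 then b else b + 1))
            ((((if σ = 0 then a + 1 else a : ℕ) : ℝ) - (if σ = 0 then b else b + 1 : ℕ)) / 2)) +
        Δ * |t| := by
  set a' : ℕ := if σ = 0 then a + 1 else a with ha'
  set b' : ℕ := if σ = 0 then b else b + 1 with hb'
  set H := hamiltonian G t U with hH
  have hHerm : H.IsHermitian := LiebThm1.hamiltonian_isHermitian G t U
  set E := H.minEnergyOn (szSector (a + b) (((a : ℝ) - b) / 2)) with hE
  -- a nonzero vector of the upper sector
  obtain ⟨φ₀, hφ₀0, hφ₀⟩ := exists_ne_zero_isInSector (Λ := Λ) ha hb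
  have hφ₀mem : φ₀ ∈ szSector (a' + b') (((a' : ℝ) - b') / 2) :=
    (isInSector_iff_mem_szSector a' b' φ₀).1 hφ₀
  suffices h : E - Δ * |t| ≤ H.minEnergyOn (szSector (a' + b') (((a' : ℝ) - b') / 2)) by linarith
  refine le_minEnergyOn_of_forall _ hφ₀mem hφ₀0 fun φ hφmem hφ1 => ?_
  have hφ : IsInSector a' b' φ := (isInSector_iff_mem_szSector a' b' φ).2 hφmem
  have hpos : 0 < (if σ = 0 then a' else b' : ℕ) := by
    fin_cases σ <;> simp [ha', hb']
  have hlow : ∀ x : Λ, IsInSector a b (annihilation (orb x σ) *ᵥ φ) := fun x =>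
    IsInSector.annihilation_spin σ hφ x
  have hEw : ∀ w : Fock (Orb Λ), IsInSector a b w →
      E * (star w ⬝ᵥ w).re ≤ (star w ⬝ᵥ (H *ᵥ w)).re := fun w hw =>
    minEnergyOn_mul_le_re hHerm _ ((isInSector_iff_mem_szSector a b w).1 hw)
  have h := removal_step G hΔ t hU σ hφ hpos hlow hEw
  rw [hφ1, Complex.one_re, mul_one, mul_one] at h
  linarith

end Graph

/-! ### The torus: `E(2n, 0) ≤ E(2n + 2, 0) + 8|t|` -/

section Torus

variable (L : ℕ) [NeZero L]

/-- **Two-electron removal window on the torus.** For the repulsive Hubbard model on `(ℤ/Lℤ)²`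
(maximal degree `4`) and `n + 1 ≤ L²`:
`minEnergyOn H (szSector (2n) 0) ≤ minEnergyOn H (szSector (2n + 2) 0) + 8|t|`,
`H = hubbardTorus 2 L t U`, `U ≥ 0` — remove a down electron (sector `(n+1, n+1) → (n+1, n)`), then
an up electron (`(n+1, n) → (n, n)`), each at cost `≤ 4|t|`. This is the lower half
`E(N,0) ≤ E(N+2,0) + 8` (at `t = 1`) of the route's pair chemical-potential window. [folklore] -/
theorem minEnergyOn_szSector_le_add_two (t : ℝ) {U : ℝ} (hU : 0 ≤ U) {n : ℕ} (hn : n + 1 ≤ L ^ 2) :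
    (hubbardTorus 2 L t U).minEnergyOn (szSector (2 * n) 0) ≤
      (hubbardTorus 2 L t U).minEnergyOn (szSector (2 * n + 2) 0) + 8 * |t| := by
  have hΔ : ∀ x : FermionTorus 2 L, (Finset.univ.filter ((fermionTorusGraph 2 L).Adj x)).card ≤ 4 :=
    fun x => (SourceGas.card_filter_fermionTorusGraph_adj_le (d := 2) (L := L) x).trans (by norm_num)
  have hcard : n + 1 ≤ Fintype.card (FermionTorus 2 L) := by rwa [card_fermionTorus 2 L]
  -- step 1: `(n, n) → (n + 1, n)` (remove an up electron)
  have h1 := minEnergyOn_sector_le_add (fermionTorusGraph 2 L) hΔ t hU 0 n n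
    (by simpa using hcard) (by simp only [if_true]; omega)
  -- step 2: `(n + 1, n) → (n + 1, n + 1)` (remove a down electron)
  have h2 := minEnergyOn_sector_le_add (fermionTorusGraph 2 L) hΔ t hU 1 (n + 1) n
    (by simp only [one_ne_zero, if_false]; omega) (by simpa using hcard)
  simp only [if_true, one_ne_zero, if_false] at h1 h2
  have e0 : szSector (Λ := FermionTorus 2 L) (n + n) (((n : ℝ) - n) / 2) = szSector (2 * n) 0 := by
    congr 1 <;> ring
  have e2 : szSector (Λ := FermionTorus 2 L) (n + 1 + (n + 1))
      ((((n + 1 : ℕ) : ℝ) - ((n + 1 : ℕ) : ℝ)) / 2) = szSector (2 * n + 2) 0 := by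
    congr 1 <;> ring
  rw [e0] at h1
  rw [e2] at h2
  change (hamiltonian (fermionTorusGraph 2 L) t U).minEnergyOn _ ≤
    (hamiltonian (fermionTorusGraph 2 L) t U).minEnergyOn _ + _
  push_cast at h1 h2 ⊢
  linarith

end Torus

end Summit.HubbardSuperconductivity.HubbardSuperconductivity.Theorems.EnslavedA1g.UpperSandwich
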